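import Mathlib.Analysis.InnerProductSpace.Adjoint
import Literature.MathematicalPhysics.QuantumFieldTheory.Balaban1983to89.B9Thm312Whole
import Literature.MathematicalPhysics.QuantumFieldTheory.Balaban1983to89.B9Thm37Glue
import HarnessLib

/-!
# Route `UnitScaleTilt` (α), node N06(d = 3), layer 0 ∕ brick L0f (the 𝔰𝔲(2)∕realification COORDINATE JUNCTION `𝔬_T3 : B9Thm312Whole.Ops (geo9K i) (bgT3 i) X Y Z W`) —
# **TRANSPOSE PAIRS, SYMMETRY AND POSITIVITY OF COORDINATE-CONJUGATED OPERATORS = ADJOINT PAIRS, SELF-ADJOINTNESS AND POSITIVITY FOR THE ORIGINAL PAIRING** (generic, def-free)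

Cell `ym-inputs` (D-0154 (2); desk `ym-inputs-plan-1` INPUT-LIST v6 §4 row p05 = I-06 (d); ym-inputs-p01's DEFINER-MEMO-T3.md brick L0f «ℝ-coordinates of the layer-0 letters via a
frame»), seat ym-inputs-p05, design point (J1) of the seat's bus line 2026-08-28 ≈09:15Z.  Count-neutral helper (`--supports stmt-QuantumFields-20520 --as helper`; RULING g26-№2);
registry untouched; THEOREMS ONLY (0 `def`, 0 `sorry`); NOTHING of [Balaban1985BackgroundPropagators] is asserted.

THE POINT.  Track A's ℝ-model letters `B9Thm312Whole.Ops` act on coordinate lattices `X → ℝ`, and the leaves' algebraic rows speak the UNWEIGHTED component pairing: `Identities.adjQ`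
(`Q f ⬝ᵥ b = f ⬝ᵥ Q* b`), `adjDv`, `symmR`, `FormSmall.posS0` ∕ `PosDefKOfOps` (`PosDefEnd T : ∀ f ≠ 0, 0 < f ⬝ᵥ T f`) and the symmetry rows `hsymGG`∕`hsym` (`B9Thm37Glue.IsTransposePair`,
reduced to four letter symmetries by ✓ `Prop7SectET3OpsSymmetry`).  Layer 0 (ym-inputs-p01, ✓ `…SectET3HilbertLettersT3`, ✓ `…SectET3GaugeProjectorT3`, L0b∕L0d pending) builds the
curved letters as (ℂ-)linear maps on WEIGHTED L² spaces of M₂(ℂ)-valued lattice fields with genuine Hilbert adjoints (`adjoint_DL2`, `laplaceALatticeK_isSymmetric`, …).  The junction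
L0f conjugates them by COORDINATE EQUIVALENCES `e : M ≃ₗ[ℝ] (X → ℝ)` that turn the model pairing `P` (e.g. `w·Re⟪·,·⟫_ℂ`) into the component sum: `Σ_x (e u)(x)·(e v)(x) = P u v`
(orthonormal real coordinates scaled by √weight).  THIS FILE proves, once and for all and for ANY such `e`, that under conjugation: transpose pair ⟺ adjoint pair for `P` (§1), symmetric ⟺
`P`-symmetric, `PosDefEnd` ⟺ `P`-positive (§2), and — for complex inner product spaces read through `Re⟪·,·⟫_ℂ` with a ℂ-linear partner — transpose pair ⟺ FULL complex adjointness
`⟪A u, v⟫_ℂ = ⟪u, B v⟫_ℂ` (§3; the imaginary part from `v ↦ I•v`).  So every adjoint ∕ self-adjointness ∕ positivity theorem of layer 0 becomes the corresponding `Ops`-row by `exact`.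

WHAT IS PROVED (ns `…Theorems.Prop7SectET3CoordJunction`): §1 `dotProduct_coord`, ★★ `isTransposePair_conj_iff`, `isTransposePair_conj_self_iff`; §2 ★ `posDefEnd_conj_iff`,
`dotProduct_conj_apply`; §3 ★★ `isTransposePair_conj_iff_inner` (complex Hilbert letters, ℂ-linear partner); §4 `conj_comp_conj`, `conj_id`, `conj_inj_iff`, `conj_eq_zero_iff` (the
ring∕composition identities of `B9Thm312Whole.Identities` transfer term by term; for endomorphisms of ONE lattice Mathlib's `LinearEquiv.conj`∕`algConj` is the same map).
HONEST SCOPE: finite-dimensional linear algebra ([folklore]); no coordinate equivalence is CONSTRUCTED here (that is the definitions-lane brick of layer 0); no estimate of [B9]; N06(d = 3)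
NOT discharged; nothing here claims EX, the crux, d = 4 or the mass gap; YM₃ on T³ is ladder rung R3, not the Clay problem.

References: T. Bałaban, CMP **99** (1985) 389–434 [Balaban1985BackgroundPropagators] (p.391 «The adjoints are taken with respect to natural L² scalar products»; Thm 3.11 p.416).
-/

set_option autoImplicit false

namespace Summit.QuantumFields.YangMills.Theorems.Prop7SectET3CoordJunction

open Literature.MathematicalPhysics.QuantumFieldTheory.Balaban1983to89
open Literature.MathematicalPhysics.QuantumFieldTheory.Balaban1983to89.B9Thm37Glue (IsTransposePair)
open Literature.MathematicalPhysics.QuantumFieldTheory.Balaban1983to89.B9Thm312Whole (PosDefEnd)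

/-! ## §1 Transpose pairs of conjugated operators -/

section Pairing

variable {M₁ M₂ : Type} [AddCommGroup M₁] [Module ℝ M₁] [AddCommGroup M₂] [Module ℝ M₂]
variable {X Y : Type} [Fintype X] [Fintype Y]

/-- The component pairing of coordinate vectors IS the model pairing: `(e u) ⬝ᵥ (e v) = P u v` — a restatement of the coordinate hypothesis in `dotProduct` form. [folklore] -/
theorem dotProduct_coord (e : M₁ ≃ₗ[ℝ] (X → ℝ)) (P : M₁ → M₁ → ℝ) (he : ∀ u v, ∑ x, e u x * e v x = P u v) (u v : M₁) : e u ⬝ᵥ e v = P u v :=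
  he u v

/-- ★★ **TRANSPOSE PAIR OF THE CONJUGATES ⟺ ADJOINT PAIR FOR THE MODEL PAIRINGS.**  For coordinate equivalences `e₁ : M₁ ≃ (X → ℝ)`, `e₂ : M₂ ≃ (Y → ℝ)` turning the pairings `P₁`, `P₂`
into component sums, the conjugated operators `e₂ ∘ A ∘ e₁⁻¹ : (X → ℝ) → (Y → ℝ)` and `e₁ ∘ B ∘ e₂⁻¹` form a transpose pair (the leaves' `IsTransposePair`, unweighted) iff
`P₂ (A u) v = P₁ u (B v)` for all `u`, `v` (the weighted L² adjointness of layer 0, p. 391). [cite: Balaban1985BackgroundPropagators, p.391] -/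
theorem isTransposePair_conj_iff (e₁ : M₁ ≃ₗ[ℝ] (X → ℝ)) (e₂ : M₂ ≃ₗ[ℝ] (Y → ℝ)) (P₁ : M₁ → M₁ → ℝ) (P₂ : M₂ → M₂ → ℝ)
    (h₁ : ∀ u v, ∑ x, e₁ u x * e₁ v x = P₁ u v) (h₂ : ∀ u v, ∑ y, e₂ u y * e₂ v y = P₂ u v) (A : M₁ →ₗ[ℝ] M₂) (B : M₂ →ₗ[ℝ] M₁) :
    IsTransposePair (e₂.toLinearMap ∘ₗ A ∘ₗ e₁.symm.toLinearMap) (e₁.toLinearMap ∘ₗ B ∘ₗ e₂.symm.toLinearMap) ↔ ∀ u v, P₂ (A u) v = P₁ u (B v) := by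
  constructor
  · intro h u v
    have := h (e₁ u) (e₂ v)
    simp only [LinearMap.coe_comp, LinearEquiv.coe_coe, Function.comp_apply, LinearEquiv.symm_apply_apply] at this
    rw [← h₂ (A u) v, ← h₁ u (B v)]
    exact this
  · intro h f b
    have := h (e₁.symm f) (e₂.symm b)
    rw [← h₂, ← h₁] at this
    simpa only [LinearMap.coe_comp, LinearEquiv.coe_coe, Function.comp_apply, LinearEquiv.apply_symm_apply] using this

/-- **SYMMETRY**: the conjugate `e ∘ T ∘ e⁻¹` is symmetric for the component pairing (`IsTransposePair T′ T′`, the shape of the letter-symmetry rows `S0`∕`Tpi`∕`T2` and of `symmR`) iff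
`T` is symmetric for the model pairing `P`. [cite: Balaban1985BackgroundPropagators, p.391] -/
theorem isTransposePair_conj_self_iff (e : M₁ ≃ₗ[ℝ] (X → ℝ)) (P : M₁ → M₁ → ℝ) (he : ∀ u v, ∑ x, e u x * e v x = P u v) (T : M₁ →ₗ[ℝ] M₁) :
    IsTransposePair (e.toLinearMap ∘ₗ T ∘ₗ e.symm.toLinearMap) (e.toLinearMap ∘ₗ T ∘ₗ e.symm.toLinearMap) ↔ ∀ u v, P (T u) v = P u (T v) :=
  isTransposePair_conj_iff e e P P he he T T

end Pairing

/-! ## §2 Positivity of conjugated operators -/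

section Positivity

variable {M : Type} [AddCommGroup M] [Module ℝ M] {X : Type} [Fintype X]

/-- The quadratic form of the conjugate at a coordinate vector: `f ⬝ᵥ (e T e⁻¹) f = P (e⁻¹ f) (T (e⁻¹ f))`. [folklore] -/
theorem dotProduct_conj_apply (e : M ≃ₗ[ℝ] (X → ℝ)) (P : M → M → ℝ) (he : ∀ u v, ∑ x, e u x * e v x = P u v) (T : M →ₗ[ℝ] M) (f : X → ℝ) :
    f ⬝ᵥ (e.toLinearMap ∘ₗ T ∘ₗ e.symm.toLinearMap) f = P (e.symm f) (T (e.symm f)) := by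
  have := he (e.symm f) (T (e.symm f))
  rw [LinearEquiv.apply_symm_apply] at this
  simpa only [dotProduct, LinearMap.coe_comp, LinearEquiv.coe_coe, Function.comp_apply] using this

/-- ★ **POSITIVE DEFINITENESS** (`B9Thm312Whole.PosDefEnd`, the shape of `FormSmall.posS0` and of the pin `PosDefKOfOps` — Theorem 3.11's meaning): the conjugate `e ∘ T ∘ e⁻¹` is
positive definite for the component pairing iff `P u (T u) > 0` for every `u ≠ 0`. [cite: Balaban1985BackgroundPropagators, Thm 3.11 p.416] -/
theorem posDefEnd_conj_iff (e : M ≃ₗ[ℝ] (X → ℝ)) (P : M → M → ℝ) (he : ∀ u v, ∑ x, e u x * e v x = P u v) (T : M →ₗ[ℝ] M) :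
    PosDefEnd (e.toLinearMap ∘ₗ T ∘ₗ e.symm.toLinearMap) ↔ ∀ u : M, u ≠ 0 → 0 < P u (T u) := by
  constructor
  · intro h u hu
    have hf : e u ≠ 0 := fun h0 => hu (by simpa using congrArg e.symm h0)
    have := h (e u) hf
    rwa [dotProduct_conj_apply e P he T, LinearEquiv.symm_apply_apply] at this
  · intro h f hf
    rw [dotProduct_conj_apply e P he T]
    exact h (e.symm f) fun h0 => hf (by simpa using congrArg e h0)

end Positivity

/-! ## §3 Complex Hilbert letters read through the real part of the inner product -/

section Complex

open scoped InnerProductSpace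

variable {E₁ E₂ : Type} [NormedAddCommGroup E₁] [InnerProductSpace ℂ E₁] [NormedAddCommGroup E₂] [InnerProductSpace ℂ E₂]
variable {X Y : Type} [Fintype X] [Fintype Y]

/-- ★★ **COMPLEX HILBERT LETTERS**: if the coordinates read the REAL PART of the complex inner products (`Σ_x (e u)(x)·(e v)(x) = Re⟪u, v⟫_ℂ`, e.g. √weight-scaled real and imaginary parts
of orthonormal components) and the partner `B` is ℂ-LINEAR, then the conjugates of `A`, `B` (ℝ-linear readings) form a transpose pair iff `⟪A u, v⟫_ℂ = ⟪u, B v⟫_ℂ` for all `u`, `v`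
— full complex adjointness, the imaginary part recovered from `v ↦ I • v`.  With layer 0's Hilbert adjoints (`adjoint_DL2`, the self-adjoint `laplaceALatticeK`-type letters) this
gives the leaves' `adjQ`∕`adjDv`∕`symmR` and the four letter symmetries by `exact`. [cite: Balaban1985BackgroundPropagators, p.391 («The adjoints are taken with respect to natural L² scalar products»)] -/
theorem isTransposePair_conj_iff_inner (e₁ : E₁ ≃ₗ[ℝ] (X → ℝ)) (e₂ : E₂ ≃ₗ[ℝ] (Y → ℝ))
    (h₁ : ∀ u v, ∑ x, e₁ u x * e₁ v x = (⟪u, v⟫_ℂ).re) (h₂ : ∀ u v, ∑ y, e₂ u y * e₂ v y = (⟪u, v⟫_ℂ).re)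
    (A : E₁ →ₗ[ℝ] E₂) (B : E₂ →ₗ[ℂ] E₁) :
    IsTransposePair (e₂.toLinearMap ∘ₗ A ∘ₗ e₁.symm.toLinearMap) (e₁.toLinearMap ∘ₗ (B.restrictScalars ℝ) ∘ₗ e₂.symm.toLinearMap) ↔
      ∀ u v, ⟪A u, v⟫_ℂ = ⟪u, B v⟫_ℂ := by
  rw [isTransposePair_conj_iff e₁ e₂ (fun u v => (⟪u, v⟫_ℂ).re) (fun u v => (⟪u, v⟫_ℂ).re) h₁ h₂ A (B.restrictScalars ℝ)]
  constructor
  · intro h u v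
    apply Complex.ext
    · exact h u v
    · -- the imaginary part from the real part at `I • v`
      have hI := h u (Complex.I • v)
      simp only [LinearMap.coe_restrictScalars, map_smul, inner_smul_right] at hI
      have e1 : (Complex.I * ⟪A u, v⟫_ℂ).re = -(⟪A u, v⟫_ℂ).im := by simp
      have e2 : (Complex.I * ⟪u, B v⟫_ℂ).re = -(⟪u, B v⟫_ℂ).im := by simp
      linarith [hI, e1, e2]
  · intro h u v
    simp only [LinearMap.coe_restrictScalars, h u v]

end Complex

/-! ## §4 Composition bookkeeping for conjugated letters (the `Identities` rows transfer) -/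

section Conj

variable {M₁ M₂ M₃ : Type} [AddCommGroup M₁] [Module ℝ M₁] [AddCommGroup M₂] [Module ℝ M₂] [AddCommGroup M₃] [Module ℝ M₃]
variable {X Y W : Type}

/-- Conjugates compose to the conjugate of the composition: `(e₃ A e₂⁻¹) ∘ (e₂ B e₁⁻¹) = e₃ (A ∘ B) e₁⁻¹` — so the composite letters of `B9Thm312Whole.Identities` (`Q ∘ G₁ ∘ Q* ∘ C₁`,
`R ∘ D* ∘ G₁ ∘ Q*`, …) conjugate term by term. [folklore] -/
theorem conj_comp_conj (e₁ : M₁ ≃ₗ[ℝ] (X → ℝ)) (e₂ : M₂ ≃ₗ[ℝ] (Y → ℝ)) (e₃ : M₃ ≃ₗ[ℝ] (W → ℝ)) (A : M₂ →ₗ[ℝ] M₃) (B : M₁ →ₗ[ℝ] M₂) :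
    (e₃.toLinearMap ∘ₗ A ∘ₗ e₂.symm.toLinearMap) ∘ₗ (e₂.toLinearMap ∘ₗ B ∘ₗ e₁.symm.toLinearMap) = e₃.toLinearMap ∘ₗ (A ∘ₗ B) ∘ₗ e₁.symm.toLinearMap := by
  apply LinearMap.ext
  intro f
  simp only [LinearMap.coe_comp, LinearEquiv.coe_coe, Function.comp_apply, LinearEquiv.symm_apply_apply]

/-- The conjugate of the identity is the identity. [folklore] -/
theorem conj_id (e : M₁ ≃ₗ[ℝ] (X → ℝ)) : e.toLinearMap ∘ₗ (LinearMap.id : M₁ →ₗ[ℝ] M₁) ∘ₗ e.symm.toLinearMap = LinearMap.id := by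
  apply LinearMap.ext
  intro f
  simp only [LinearMap.coe_comp, LinearEquiv.coe_coe, Function.comp_apply, LinearMap.id_coe, id_eq, LinearEquiv.apply_symm_apply]

/-- Conjugation is injective on operators: `e₂ A e₁⁻¹ = e₂ B e₁⁻¹ ↔ A = B` — so an identity between conjugated letters IS the model identity (e.g. `Identities.c1_inv`, `h124Q`,
`h124R`, `hR`, `eq126`, `eq129`, `eq153` transfer in both directions). [folklore] -/
theorem conj_inj_iff (e₁ : M₁ ≃ₗ[ℝ] (X → ℝ)) (e₂ : M₂ ≃ₗ[ℝ] (Y → ℝ)) (A B : M₁ →ₗ[ℝ] M₂) :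
    e₂.toLinearMap ∘ₗ A ∘ₗ e₁.symm.toLinearMap = e₂.toLinearMap ∘ₗ B ∘ₗ e₁.symm.toLinearMap ↔ A = B := by
  constructor
  · intro h
    apply LinearMap.ext
    intro u
    have := LinearMap.congr_fun h (e₁ u)
    simp only [LinearMap.coe_comp, LinearEquiv.coe_coe, Function.comp_apply, LinearEquiv.symm_apply_apply] at this
    exact e₂.injective this
  · rintro rfl
    rfl

/-- The conjugate of the zero map is zero, and only of it: `e₂ A e₁⁻¹ = 0 ↔ A = 0` (the (3.124) rows `h124Q`∕`h124R`). [folklore] -/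
theorem conj_eq_zero_iff (e₁ : M₁ ≃ₗ[ℝ] (X → ℝ)) (e₂ : M₂ ≃ₗ[ℝ] (Y → ℝ)) (A : M₁ →ₗ[ℝ] M₂) :
    e₂.toLinearMap ∘ₗ A ∘ₗ e₁.symm.toLinearMap = 0 ↔ A = 0 := by
  have h := conj_inj_iff e₁ e₂ A 0
  rwa [LinearMap.zero_comp, LinearMap.comp_zero] at h

end Conj

end Summit.QuantumFields.YangMills.Theorems.Prop7SectET3CoordJunction
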